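import Summits.BirchSwinnertonDyer.BirchSwinnertonDyer.Theses.SemiOrdinaryEisensteinDescent
import Summits.BirchSwinnertonDyer.BirchSwinnertonDyer.Theorems.SemiOrdinaryEisensteinDescentWildKolyvaginUpperAtThreeTowerFreeJetchevMaxModThree
import HarnessLib

/-!
# Route `SemiOrdinaryEisensteinDescent` (rev 19), support item `JetchevMaxOfConjGlue` (stmt-BirchSwinnertonDyer-26257):
# the CONJUGATION-COMPATIBLE Poitou–Tate input (item 23092 `PoitouTateSelmerDualityConjInput`) implies the filed
# Jetchev max-form item `JetchevMaxDivisibilityAtThreeModThree` (25897) — PROVED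

Cell `bsd-wall` (W-ALL row 2·3@3, SOED Kolyvagin branch), width seat `bsd-wall-soed-p2-w3` (gen 3), 2026-08-28, on the route
pen's rev-19 repair of the vets' finding G1 (bsd-vet-tk5i g2/g3, soed-p2-w2 g5 p608444): as filed, item 25897's first antecedent is
the FOUR-conjunct Selmer-structure duality `PoitouTateSelmerStructureDualityFact`, while the tree's proof of Jetchev's max-form
divisibility read modulo `3` (`WildKolyvaginUpperAtThreeTowerFreeJetchevMaxModThree.jetchevMaxModThree_of_literature`, soed-p2-w2 g5,
over the JET ModP series = Jetchev 2008 Thm. 5.1 run sign by sign on the `τ`-eigenspaces) needs the FIVE-conjunct fact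
`poitouTate_selmerStructure_duality_conj` (the fifth conjunct = compatibility of the local invariant maps with the Galois
transport of completions, Neukirch III §6). The pen therefore filed the five-conjunct input BY NAME (23092) and this glue item,
and re-keyed `closes` to `hGJ hPTc`. The theorem below has LITERALLY the type
`Summit.BirchSwinnertonDyer.BirchSwinnertonDyer.Theses.SemiOrdinaryEisensteinDescent.JetchevMaxOfConjGlue`.

PROOF (the item's recipe, zero new mathematics): introduce the conj-form input `hc`, DISCARD 25897's own four-conjunct antecedent,
and feed `hc` with the two Gross 1991 primitives (E⁰ membership, Prop. 3.7 (2)) to `jetchevMaxModThree_of_literature`; the two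
primitive items `GrossHeegnerPointE0Input` / `GrossProp372FrobeniusCongruenceInput` are definitionally the Literature facts that
theorem consumes.

HONEST FRAMING. This closes a SUPPORT (glue) item: an implication between named route statements. Its antecedent (the
five-conjunct Poitou–Tate duality for Selmer structures at every number field) and the two Gross primitives inside 25897 remain
Literature named facts, undischarged; the research cruxes E′ (24155), J‴ (25898), Z (20387) are untouched. Nothing about any curve
is asserted unconditionally. BSD is not proved by this file.
-/

set_option autoImplicit false
set_option linter.dupNamespace false -- `Summit.BirchSwinnertonDyer.BirchSwinnertonDyer.…` is the tree's layout (D-0017)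

noncomputable section

open scoped Classical

namespace Summit.BirchSwinnertonDyer.BirchSwinnertonDyer.Theorems

open Summit.BirchSwinnertonDyer.BirchSwinnertonDyer.Theses.SemiOrdinaryEisensteinDescent

/-- **Glue `JetchevMaxOfConjGlue` (stmt-BirchSwinnertonDyer-26257), PROVED**: the conjugation-compatible Poitou–Tate input
`PoitouTateSelmerDualityConjInput` (∀ K, `poitouTate_selmerStructure_duality_conj K`) implies the filed Jetchev max-form item
`JetchevMaxDivisibilityAtThreeModThree` — whose own four-conjunct Poitou–Tate antecedent is ignored — by soed-p2-w2 g5's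
`jetchevMaxModThree_of_literature` fed with the Gross 1991 E⁰ and Prop. 3.7 (2) antecedents. An implication between named route
statements; the named facts stay undischarged. [cite: Jetchev2008, Thm. 1.4 (p. 812) and Thm. 5.1]
[cite: MilneADT2006, Ch. I, Thm. 4.10(b)] [cite: Neukirch2013, Ch. III §6] [cite: GrossLMS1991, Prop. 3.7 (2) p. 240] -/
theorem semiOrdinaryEisensteinDescent_jetchevMaxOfConjGlue_proof : JetchevMaxOfConjGlue := by
  intro hc _ hE0 h372
  exact WildKolyvaginUpperAtThreeTowerFreeJetchevMaxModThree.jetchevMaxModThree_of_literature hc hE0 h372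

end Summit.BirchSwinnertonDyer.BirchSwinnertonDyer.Theorems

end
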